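import Mathlib

/-!
# Crux `MonotoneSuffices` (stmt-PneNP-18026), line `slice-transport` — stub `stub_transport`, part 1:
# equidistribution of the lowest-ranked `d` present coordinates

The transport gadget of `stub_transport` deletes, from an edge vector `x`, the `d` present edges of
LOWEST RANK for a ranking `σ : α ≃ Fin |α|` of the coordinates. For a finset `s` (the support of
`x`) write `T σ d s = {a ∈ s | #{b ∈ s | σ b < σ a} < d}` for the `d` lowest-ranked elements of `s`.
This file proves that, as `σ` ranges over ALL rankings, `T σ d s` is EQUIDISTRIBUTED over the
`d`-subsets of `s` (`card_filter_lowest_eq_const`), in the summed form used downstream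
(`sum_lowest_mul_choose`): `(∑_σ G (T σ d s)) · C(#s, d) = #(α ≃ Fin |α|) · ∑_{D ⊆ s, #D = d} G D`.
Proof: for a permutation `τ` of `α` preserving `s`, `T (τ.trans σ) d s = τ⁻¹ (T σ d s)`
(`mem_lowest_perm_trans`), and the permutations preserving `s` act transitively on the `d`-subsets
of `s` (`exists_perm_map_subset`). Generic in a finite type `α`; no circuits or probability here.
-/

set_option linter.dupNamespace false -- `Summit.PneNP.PneNP.…`: summit = sub-problem name (D-0017 single-conjunct layout)

namespace Summit.PneNP.PneNP.Theorems.MonotoneSuffices.SliceTransport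

open Finset

variable {α : Type*} [Fintype α]

/-! ### Ranks inside a finset -/

/-- The rank of `a` inside `s` (number of elements of `s` ranked strictly below `a`) is `< #s`
for `a ∈ s`. [folklore] -/
theorem card_filter_rank_lt_card (σ : α ≃ Fin (Fintype.card α)) (s : Finset α) {a : α} (ha : a ∈ s) :
    #(s.filter fun b => σ b < σ a) < #s := by
  apply card_lt_card
  refine ⟨filter_subset _ _, fun h => ?_⟩
  have := (mem_filter.1 (h ha)).2
  exact lt_irrefl _ this

/-- Ranks inside `s` are strictly monotone in `σ`. [folklore] -/
theorem card_filter_rank_lt_of_lt (σ : α ≃ Fin (Fintype.card α)) (s : Finset α) {a b : α}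
    (ha : a ∈ s) (hab : σ a < σ b) :
    #(s.filter fun c => σ c < σ a) < #(s.filter fun c => σ c < σ b) := by
  apply card_lt_card
  refine ⟨fun c hc => ?_, fun h => ?_⟩
  · rw [mem_filter] at hc ⊢
    exact ⟨hc.1, hc.2.trans hab⟩
  · have : a ∈ s.filter fun c => σ c < σ a := h (mem_filter.2 ⟨ha, hab⟩)
    exact lt_irrefl _ (mem_filter.1 this).2

/-- The rank map is injective on `s`. [folklore] -/
theorem rank_injOn (σ : α ≃ Fin (Fintype.card α)) (s : Finset α) :
    Set.InjOn (fun a => #(s.filter fun c => σ c < σ a)) s := by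
  intro a ha b hb hab
  by_contra hne
  have hσ : σ a ≠ σ b := fun h => hne (σ.injective h)
  rcases lt_or_gt_of_ne hσ with hlt | hlt
  · exact absurd hab (ne_of_lt (card_filter_rank_lt_of_lt σ s ha hlt))
  · exact absurd hab (ne_of_gt (card_filter_rank_lt_of_lt σ s hb hlt))

/-- The ranks inside `s` are exactly `0, …, #s - 1`. [folklore] -/
theorem image_rank_eq_range (σ : α ≃ Fin (Fintype.card α)) (s : Finset α) :
    s.image (fun a => #(s.filter fun c => σ c < σ a)) = range #s := by
  apply eq_of_subset_of_card_le
  · intro r hr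
    rw [mem_image] at hr
    obtain ⟨a, ha, rfl⟩ := hr
    exact mem_range.2 (card_filter_rank_lt_card σ s ha)
  · rw [card_range, card_image_of_injOn (rank_injOn σ s)]

/-- **The `d` lowest-ranked elements of `s` are `d` of them** (`d ≤ #s`). [folklore] -/
theorem card_lowest (σ : α ≃ Fin (Fintype.card α)) (s : Finset α) {d : ℕ} (hd : d ≤ #s) :
    #(s.filter fun a => #(s.filter fun c => σ c < σ a) < d) = d := by
  -- the rank map is a bijection `s → range #s`; the set in question is the preimage of `range d`
  have hinj := rank_injOn σ s
  have key : (s.filter fun a => #(s.filter fun c => σ c < σ a) < d).image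
      (fun a => #(s.filter fun c => σ c < σ a)) = range d := by
    apply eq_of_subset_of_card_le
    · intro r hr
      rw [mem_image] at hr
      obtain ⟨a, ha, rfl⟩ := hr
      exact mem_range.2 (mem_filter.1 ha).2
    · -- every `r < d ≤ #s` is a rank
      have hsub : range d ⊆ (s.filter fun a => #(s.filter fun c => σ c < σ a) < d).image
          (fun a => #(s.filter fun c => σ c < σ a)) := by
        intro r hr
        have hr' : r ∈ range #s := mem_range.2 ((mem_range.1 hr).trans_le hd)
        rw [← image_rank_eq_range σ s, mem_image] at hr'
        obtain ⟨a, ha, har⟩ := hr'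
        rw [mem_image]
        refine ⟨a, mem_filter.2 ⟨ha, ?_⟩, har⟩
        rw [har]; exact mem_range.1 hr
      exact card_le_card hsub
  have hinj' : Set.InjOn (fun a => #(s.filter fun c => σ c < σ a))
      ↑(s.filter fun a => #(s.filter fun c => σ c < σ a) < d) :=
    fun a ha b hb h => hinj (mem_filter.1 ha).1 (mem_filter.1 hb).1 h
  calc #(s.filter fun a => #(s.filter fun c => σ c < σ a) < d)
      = #((s.filter fun a => #(s.filter fun c => σ c < σ a) < d).image
          (fun a => #(s.filter fun c => σ c < σ a))) := (card_image_of_injOn hinj').symm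
    _ = #(range d) := by rw [key]
    _ = d := card_range d

/-- The lowest-ranked elements of `s` lie in `s`. [folklore] -/
theorem lowest_subset (σ : α ≃ Fin (Fintype.card α)) (s : Finset α) (d : ℕ) :
    (s.filter fun a => #(s.filter fun c => σ c < σ a) < d) ⊆ s := filter_subset _ _

/-! ### Equivariance under permutations preserving `s` -/

/-- For a permutation `τ` preserving `s`, ranks transform by `rank_{τ.trans σ}(a) = rank_σ(τ a)`.
[folklore] -/
theorem card_filter_rank_perm_trans (σ : α ≃ Fin (Fintype.card α)) (s : Finset α) (τ : Equiv.Perm α)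
    (hτ : ∀ a, a ∈ s ↔ τ a ∈ s) (a : α) :
    #(s.filter fun c => (τ.trans σ) c < (τ.trans σ) a) = #(s.filter fun c => σ c < σ (τ a)) := by
  refine card_bij (fun c _ => τ c) (fun c hc => ?_) (fun c₁ _ c₂ _ h => τ.injective h) (fun c hc => ?_)
  · rw [mem_filter] at hc ⊢
    exact ⟨(hτ c).1 hc.1, by simpa using hc.2⟩
  · rw [mem_filter] at hc
    refine ⟨τ.symm c, mem_filter.2 ⟨?_, ?_⟩, by simp⟩
    · rw [hτ, Equiv.apply_symm_apply]; exact hc.1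
    · simpa using hc.2

/-- **Equivariance**: `a ∈ T (τ.trans σ) d s ↔ τ a ∈ T σ d s` for `τ` preserving `s`. [folklore] -/
theorem mem_lowest_perm_trans (σ : α ≃ Fin (Fintype.card α)) (s : Finset α) (τ : Equiv.Perm α)
    (hτ : ∀ a, a ∈ s ↔ τ a ∈ s) (d : ℕ) (a : α) :
    a ∈ (s.filter fun a' => #(s.filter fun c => (τ.trans σ) c < (τ.trans σ) a') < d) ↔
      τ a ∈ (s.filter fun a' => #(s.filter fun c => σ c < σ a') < d) := by
  rw [mem_filter, mem_filter, card_filter_rank_perm_trans σ s τ hτ a, ← hτ a]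

/-! ### Transitivity: permutations preserving `s` move any `d`-subset of `s` to any other -/

/-- **Two `d`-subsets of `s` are exchanged by a permutation preserving `s`.** [folklore] -/
theorem exists_perm_map_subset [DecidableEq α] {s D D' : Finset α} (hD : D ⊆ s) (hD' : D' ⊆ s)
    (hcard : #D = #D') :
    ∃ τ : Equiv.Perm α, (∀ a, a ∈ s ↔ τ a ∈ s) ∧ (∀ a, a ∈ D' ↔ τ a ∈ D) := by
  classical
  -- bijections `D' ≃ D` and `s \ D' ≃ s \ D`
  have h1 : Fintype.card (D' : Finset α) = Fintype.card (D : Finset α) := by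
    rw [Fintype.card_coe, Fintype.card_coe, hcard]
  have h2 : Fintype.card (s \ D' : Finset α) = Fintype.card (s \ D : Finset α) := by
    rw [Fintype.card_coe, Fintype.card_coe, card_sdiff_of_subset hD', card_sdiff_of_subset hD, hcard]
  obtain ⟨f⟩ := Fintype.card_eq.1 h1
  obtain ⟨g⟩ := Fintype.card_eq.1 h2
  -- the glued map
  let τf : α → α := fun a =>
    if h : a ∈ D' then (f ⟨a, h⟩ : α) else if h' : a ∈ s then (g ⟨a, mem_sdiff.2 ⟨h', h⟩⟩ : α) else a
  have hτD' : ∀ a (h : a ∈ D'), τf a = f ⟨a, h⟩ := fun a h => by simp [τf, h]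
  have hτS : ∀ a (h' : a ∈ s) (h : a ∉ D'), τf a = g ⟨a, mem_sdiff.2 ⟨h', h⟩⟩ := fun a h' h => by
    simp [τf, h, h']
  have hτout : ∀ a, a ∉ s → τf a = a := fun a h => by
    have hD'a : a ∉ D' := fun h' => h (hD' h')
    simp [τf, h, hD'a]
  -- where the pieces land
  have landD' : ∀ a, a ∈ D' → τf a ∈ D := fun a h => by rw [hτD' a h]; exact (f ⟨a, h⟩).2
  have landS : ∀ a, a ∈ s → a ∉ D' → τf a ∈ s \ D := fun a h' h => by
    rw [hτS a h' h]; exact (g ⟨a, _⟩).2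
  have hinj : Function.Injective τf := by
    intro a b hab
    by_cases ha : a ∈ D' <;> by_cases hb : b ∈ D'
    · have := landD' a ha
      rw [hτD' a ha, hτD' b hb] at hab
      exact congrArg Subtype.val (f.injective (Subtype.ext hab)) |> fun h => by simpa using h
    · exfalso
      have h1 := landD' a ha
      rw [hab] at h1
      by_cases hbs : b ∈ s
      · exact (mem_sdiff.1 (landS b hbs hb)).2 h1
      · rw [hτout b hbs] at h1; exact hbs (hD h1)
    · exfalso
      have h1 := landD' b hb
      rw [← hab] at h1
      by_cases has : a ∈ s
      · exact (mem_sdiff.1 (landS a has ha)).2 h1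
      · rw [hτout a has] at h1; exact has (hD h1)
    · by_cases has : a ∈ s <;> by_cases hbs : b ∈ s
      · rw [hτS a has ha, hτS b hbs hb] at hab
        have := g.injective (Subtype.ext hab)
        simpa using congrArg Subtype.val this
      · exfalso
        have h1 := landS a has ha
        rw [hab, hτout b hbs] at h1
        exact hbs (mem_sdiff.1 h1).1
      · exfalso
        have h1 := landS b hbs hb
        rw [← hab, hτout a has] at h1
        exact has (mem_sdiff.1 h1).1
      · rwa [hτout a has, hτout b hbs] at hab
  have hbij : Function.Bijective τf := (Finite.injective_iff_bijective).1 hinj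
  refine ⟨Equiv.ofBijective τf hbij, fun a => ?_, fun a => ?_⟩
  · simp only [Equiv.ofBijective_apply]
    constructor
    · intro has
      by_cases ha : a ∈ D'
      · exact hD (landD' a ha)
      · exact (mem_sdiff.1 (landS a has ha)).1
    · intro h
      by_contra has
      rw [hτout a has] at h
      exact has h
  · simp only [Equiv.ofBijective_apply]
    constructor
    · exact landD' a
    · intro h
      by_contra ha
      by_cases has : a ∈ s
      · exact (mem_sdiff.1 (landS a has ha)).2 h
      · rw [hτout a has] at h; exact has (hD h)

/-! ### Equidistribution -/

/-- **Equidistribution of the lowest-ranked `d`-subset**: for `d`-subsets `D, D'` of `s`, the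
number of rankings `σ` whose `d` lowest-ranked elements of `s` are exactly `D` equals the number
for `D'`. [folklore] -/
theorem card_filter_lowest_eq_const [DecidableEq α] (s : Finset α) (d : ℕ) {D D' : Finset α} (hD : D ⊆ s)
    (hD' : D' ⊆ s)
    (hDc : #D = d) (hD'c : #D' = d) :
    #((univ : Finset (α ≃ Fin (Fintype.card α))).filter fun σ =>
        (s.filter fun a => #(s.filter fun c => σ c < σ a) < d) = D) =
    #((univ : Finset (α ≃ Fin (Fintype.card α))).filter fun σ =>
        (s.filter fun a => #(s.filter fun c => σ c < σ a) < d) = D') := by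
  obtain ⟨τ, hτs, hτD⟩ := exists_perm_map_subset hD hD' (hDc.trans hD'c.symm)
  -- `σ ↦ τ.trans σ` maps the fibre of `D` into the fibre of `D'`, with inverse `σ ↦ τ.symm.trans σ`
  refine card_bij (fun σ _ => τ.trans σ) (fun σ hσ => ?_) (fun σ₁ _ σ₂ _ h => ?_) (fun σ hσ => ?_)
  · rw [mem_filter] at hσ ⊢
    refine ⟨mem_univ _, ?_⟩
    ext a
    rw [mem_lowest_perm_trans σ s τ hτs d a, hσ.2, hτD a]
  · exact Equiv.ext fun a => by
      simpa using congrArg (fun e : α ≃ Fin (Fintype.card α) => e (τ.symm a)) h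
  · rw [mem_filter] at hσ
    refine ⟨τ.symm.trans σ, mem_filter.2 ⟨mem_univ _, ?_⟩, by ext a; simp⟩
    have hτs' : ∀ a, a ∈ s ↔ τ.symm a ∈ s := fun a => by
      rw [hτs (τ.symm a), Equiv.apply_symm_apply]
    ext a
    rw [mem_lowest_perm_trans σ s τ.symm hτs' d a, hσ.2]
    have := hτD (τ.symm a)
    rw [Equiv.apply_symm_apply] at this
    exact this

/-- **Averaging over rankings = averaging over `d`-subsets** (the form consumed downstream): for
`d ≤ #s` and any `G`,
`(∑_σ G (lowest_d(σ, s))) · C(#s, d) = #(α ≃ Fin |α|) · ∑_{D ∈ powersetCard d s} G D`. [folklore] -/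
theorem sum_lowest_mul_choose [DecidableEq α] (s : Finset α) {d : ℕ} (hd : d ≤ #s) (G : Finset α → ℝ) :
    (∑ σ : α ≃ Fin (Fintype.card α), G (s.filter fun a => #(s.filter fun c => σ c < σ a) < d)) *
        ((#s).choose d : ℝ) =
      (Fintype.card (α ≃ Fin (Fintype.card α)) : ℝ) * ∑ D ∈ s.powersetCard d, G D := by
  classical
  set P : Finset (Finset α) := s.powersetCard d with hP
  set T : (α ≃ Fin (Fintype.card α)) → Finset α := fun σ =>
    s.filter fun a => #(s.filter fun c => σ c < σ a) < d with hT
  have hTmem : ∀ σ, T σ ∈ P := fun σ => by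
    rw [hP, mem_powersetCard]
    exact ⟨lowest_subset σ s d, card_lowest σ s hd⟩
  -- fibre sizes are constant on `P`
  set fib : Finset α → ℕ := fun D => #((univ : Finset (α ≃ Fin (Fintype.card α))).filter fun σ => T σ = D)
    with hfib
  rcases P.eq_empty_or_nonempty with hPe | ⟨D₀, hD₀⟩
  · -- impossible: `P` contains `T σ`... unless there is no `σ`; handle uniformly
    have : IsEmpty (α ≃ Fin (Fintype.card α)) := ⟨fun σ => by simpa [hPe] using hTmem σ⟩
    simp [hPe]
  have hconst : ∀ D ∈ P, fib D = fib D₀ := by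
    intro D hD
    rw [hP, mem_powersetCard] at hD hD₀
    exact card_filter_lowest_eq_const s d hD.1 hD₀.1 hD.2 hD₀.2
  -- (1) `∑_σ G (T σ) = ∑_{D ∈ P} fib D · G D = fib D₀ · ∑_D G D`
  have h1 : ∑ σ : α ≃ Fin (Fintype.card α), G (T σ) = (fib D₀ : ℝ) * ∑ D ∈ P, G D := by
    rw [← sum_fiberwise_of_maps_to (g := T) (fun σ _ => hTmem σ), mul_sum]
    refine sum_congr rfl fun D hD => ?_
    have : ∑ σ ∈ (univ : Finset (α ≃ Fin (Fintype.card α))).filter (fun σ => T σ = D), G (T σ) =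
        ∑ σ ∈ (univ : Finset (α ≃ Fin (Fintype.card α))).filter (fun σ => T σ = D), G D :=
      sum_congr rfl fun σ hσ => by rw [(mem_filter.1 hσ).2]
    rw [this, sum_const, nsmul_eq_mul, ← hconst D hD]
  -- (2) `#Equiv = ∑_{D ∈ P} fib D = fib D₀ · #P`, `#P = C(#s, d)`
  have h2 : (Fintype.card (α ≃ Fin (Fintype.card α)) : ℝ) = (fib D₀ : ℝ) * ((#s).choose d : ℝ) := by
    have hc : Fintype.card (α ≃ Fin (Fintype.card α)) = ∑ D ∈ P, fib D := by
      rw [← card_univ]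
      exact card_eq_sum_card_fiberwise fun σ _ => hTmem σ
    rw [hc, Nat.cast_sum, sum_congr rfl fun D hD => congrArg (Nat.cast (R := ℝ)) (hconst D hD), sum_const,
      nsmul_eq_mul, hP, card_powersetCard]
    ring
  rw [h1, h2]
  ring

/-- **transport_equidistribution** (registered helper sub-goal of stmt-PneNP-18026 for `stub_transport`,
part 1): averaging any `G` over the lowest-ranked `d`-subset of `s` along all rankings equals
averaging over all `d`-subsets of `s` (`sum_lowest_mul_choose`, cross-multiplied). [folklore] -/
theorem transport_equidistribution :
    ∀ {α : Type*} [Fintype α] [DecidableEq α] (s : Finset α) (d : ℕ), d ≤ #s → ∀ G : Finset α → ℝ, (∑ σ : α ≃ Fin (Fintype.card α), G (s.filter fun a => #(s.filter fun c => σ c < σ a) < d)) * ((#s).choose d : ℝ) = (Fintype.card (α ≃ Fin (Fintype.card α)) : ℝ) * ∑ D ∈ s.powersetCard d, G D :=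
  fun s _ hd G => sum_lowest_mul_choose s hd G

end Summit.PneNP.PneNP.Theorems.MonotoneSuffices.SliceTransport
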